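import Summits.CriticalPhenomena.CardyFormulaZ2.Theses.CardyWickAnisotropy
import Literature.Probability.RandomPlanarGeometry.KlebanZagierTheorem2
import Literature.Probability.RandomPlanarGeometry.DiamondShearChart
import Literature.Analysis.SpecialFunctions.JacobiThetaLemniscatic
import Literature.Probability.RandomPlanarGeometry.CardyFunctionIncBeta
import HarnessLib

/-!
# Stub `stub_firstJetTarget` of line `birth`, crux `CardyWickAnisotropy.AnisotropicBoxCardy`
(stmt-CriticalPhenomena-14309): the first jet of the Cardy side at the self-dual square

For every holomorphic `G` on `D = ball (1/2) (1/2)` taking the Cardy values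
`G (criticalWeight (α/2)) = Π_h (cot (α/2))` on the critical segment `α ∈ (0, π)`, the first
derivative at the self-dual point is the explicit constant
`G′(1/2) = c₁ := 2√3 · (cardyConst/3) · (1/4)^(-2/3) · (π/2) · θ₄(i)⁴ = 2√3 · (−Π_h′(1))`
(`= 1.80219…`).

Proof: chain rule at `α = π/2` along the real curve `α ↦ criticalWeight (α/2)` (value `1/2`
and derivative `√3/6` at `π/2`) against the Cardy side
`α ↦ Π_h (cot (α/2)) = F (λ(i·cot (α/2)))`
(`(d/dα) cot (α/2) = -1` at `π/2`; `(d/ds) F(λ(is)) = F′(λ)·λ′` is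
`Literature.Probability.RandomPlanarGeometry.hasDerivAt_cardyFunction_lamR`; `λ(i) = 1/2` is
`Literature.Analysis.SpecialFunctions.lamR_one`), then uniqueness of the derivative of the common
function of `α` near `π/2`, and `6/√3 = 2√3`.
-/

namespace Summit.CriticalPhenomena.CardyFormulaZ2.Theorems

open scoped Classical
open Filter Topology

/-! ### The two real curves through the self-dual point -/

/-- The critical-weight curve
`α ↦ criticalWeight (α/2) = sin (α/3) / (sin (α/3) + sin ((π-α)/3))` has derivative `√3/6` at
`α = π/2` (both sines are `sin (π/6) = 1/2`, both cosines `cos (π/6) = √3/2`, and the inner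
derivatives are `±1/3`). -/
private theorem hasDerivAt_criticalWeight_half :
    HasDerivAt (fun α : ℝ ↦ Literature.Probability.LatticeModels.criticalWeight (α / 2))
      (Real.sqrt 3 / 6) (Real.pi / 2) := by
  have hl : ∀ x : ℝ, HasDerivAt (fun α : ℝ ↦ 2 * (α / 2) / 3) (2 * (1 / 2) / 3 : ℝ) x :=
    fun x ↦ (((hasDerivAt_id' x).div_const 2).const_mul 2).div_const 3
  have hm : ∀ x : ℝ, HasDerivAt (fun α : ℝ ↦ (Real.pi - 2 * (α / 2)) / 3)
      (-(2 * (1 / 2)) / 3 : ℝ) x :=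
    fun x ↦ ((((hasDerivAt_id' x).div_const 2).const_mul 2).const_sub Real.pi).div_const 3
  have hN := (hl (Real.pi / 2)).sin
  have hM := (hm (Real.pi / 2)).sin
  have h6 : 2 * (Real.pi / 2 / 2) / 3 = Real.pi / 6 := by ring
  have h6' : (Real.pi - 2 * (Real.pi / 2 / 2)) / 3 = Real.pi / 6 := by ring
  have hD : Real.sin (2 * (Real.pi / 2 / 2) / 3) +
      Real.sin ((Real.pi - 2 * (Real.pi / 2 / 2)) / 3) ≠ 0 := by
    rw [h6, h6', Real.sin_pi_div_six]; norm_num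
  have h := hN.fun_div (hN.fun_add hM) hD
  unfold Literature.Probability.LatticeModels.criticalWeight
  refine h.congr_deriv ?_
  simp only [h6, h6', Real.sin_pi_div_six, Real.cos_pi_div_six]
  ring

/-- `cot (α/2) = cos (α/2) / sin (α/2)` has derivative `-1/(2 sin² (α/2)) = -1` at
`α = π/2`. -/
private theorem hasDerivAt_cot_half :
    HasDerivAt (fun α : ℝ ↦ Real.cos (α / 2) / Real.sin (α / 2)) (-1) (Real.pi / 2) := by
  have hh : HasDerivAt (fun α : ℝ ↦ α / 2) (1 / 2 : ℝ) (Real.pi / 2) :=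
    (hasDerivAt_id' _).div_const 2
  have h4 : Real.pi / 2 / 2 = Real.pi / 4 := by ring
  have hs : Real.sin (Real.pi / 2 / 2) ≠ 0 := by rw [h4, Real.sin_pi_div_four]; positivity
  have h := hh.cos.fun_div hh.sin hs
  refine h.congr_deriv ?_
  simp only [h4, Real.sin_pi_div_four, Real.cos_pi_div_four]
  rw [div_eq_iff (by positivity : (Real.sqrt 2 / 2) ^ 2 ≠ 0)]
  ring

/-- `cot (π/4) = 1`, in the form `cos (π/2/2) / sin (π/2/2) = 1`. -/
private theorem cos_div_sin_pi_div_two_half :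
    Real.cos (Real.pi / 2 / 2) / Real.sin (Real.pi / 2 / 2) = 1 := by
  rw [show Real.pi / 2 / 2 = Real.pi / 4 by ring, Real.cos_pi_div_four, Real.sin_pi_div_four]
  exact div_self (by positivity)

/-- `Π_h (t) = F (λ(it))` for `t > 0`: the real part of `((θ₂/θ₃)(it))⁴` is `lamR t`
(`KlebanZagier.modularLambdaI_eq_lamR`). -/
private theorem cardyPi_eq_cardyFunction_lamR {t : ℝ} (ht : 0 < t) :
    Literature.Probability.RandomPlanarGeometry.cardyFunction
        (((Literature.NumberTheory.EllipticCurves.JacobiThetaNull.theta2 (Complex.I * (t : ℂ)) /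
          Literature.NumberTheory.EllipticCurves.JacobiThetaNull.theta3
            (Complex.I * (t : ℂ))) ^ 4).re) =
      Literature.Probability.RandomPlanarGeometry.cardyFunction
        (Literature.Probability.RandomPlanarGeometry.KlebanZagier.lamR t) :=
  congrArg Literature.Probability.RandomPlanarGeometry.cardyFunction
    (Literature.Probability.RandomPlanarGeometry.KlebanZagier.modularLambdaI_eq_lamR ht)

/-- The real arithmetic of the constant: with `λ(i) = 1/2`,
`(F′(λ(i)) · λ′(i)) · (-1) / (√3/6) = 2√3 · (cardyConst/3) · (1/4)^(-2/3) · (π/2) · θ₄(i)⁴`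
(`λ(1-λ) = 1/4`, `6/√3 = 2√3`). -/
private theorem firstJet_const_eq :
    Literature.Probability.RandomPlanarGeometry.cardyConst / 3 *
          (Literature.Probability.RandomPlanarGeometry.KlebanZagier.lamR 1 *
            (1 - Literature.Probability.RandomPlanarGeometry.KlebanZagier.lamR 1)) ^
              (-(2 / 3 : ℝ)) *
        -(Real.pi * Literature.Probability.RandomPlanarGeometry.KlebanZagier.lamR 1 *
          (Literature.NumberTheory.EllipticCurves.JacobiThetaNull.theta4
            (Complex.I * ((1 : ℝ) : ℂ))).re ^ 4) * (-1) / (Real.sqrt 3 / 6) =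
      2 * Real.sqrt 3 * (Literature.Probability.RandomPlanarGeometry.cardyConst / 3) *
        (1 / 4 : ℝ) ^ (-(2 / 3 : ℝ)) * (Real.pi / 2) *
          (Literature.NumberTheory.EllipticCurves.JacobiThetaNull.theta4 Complex.I).re ^ 4 := by
  rw [Literature.Analysis.SpecialFunctions.lamR_one, Complex.ofReal_one, mul_one,
    show (1 / 2 : ℝ) * (1 - 1 / 2) = 1 / 4 by norm_num,
    div_eq_iff (show Real.sqrt 3 / 6 ≠ 0 by positivity)]
  have h3 : Real.sqrt 3 * Real.sqrt 3 = 3 := Real.mul_self_sqrt (by norm_num)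
  linear_combination (-(Literature.Probability.RandomPlanarGeometry.cardyConst / 3 *
    (1 / 4 : ℝ) ^ (-(2 / 3 : ℝ)) * Real.pi *
      (Literature.NumberTheory.EllipticCurves.JacobiThetaNull.theta4 Complex.I).re ^ 4 / 6)) * h3

/-! ### The stub -/

/-- **Stub `stub_firstJetTarget`** (line `birth` of crux `AnisotropicBoxCardy`): every
holomorphic `G` on `D = ball (1/2) (1/2)` with the Cardy values
`G (criticalWeight (α/2)) = Π_h (cot (α/2))` on the critical segment has
`G′(1/2) = c₁ = 2√3 · (cardyConst/3) · (1/4)^(-2/3) · (π/2) · θ₄(i)⁴`. -/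
theorem stub_firstJetTarget :
    let PiH : ℝ → ℝ := fun r ↦ Literature.Probability.RandomPlanarGeometry.cardyFunction (((Literature.NumberTheory.EllipticCurves.JacobiThetaNull.theta2 (Complex.I * (r : ℂ)) / Literature.NumberTheory.EllipticCurves.JacobiThetaNull.theta3 (Complex.I * (r : ℂ))) ^ 4).re); let c₁ : ℝ := 2 * Real.sqrt 3 * (Literature.Probability.RandomPlanarGeometry.cardyConst / 3) * (1 / 4 : ℝ) ^ (-(2 / 3 : ℝ)) * (Real.pi / 2) * (Literature.NumberTheory.EllipticCurves.JacobiThetaNull.theta4 Complex.I).re ^ 4; ∀ G : ℂ → ℂ, DifferentiableOn ℂ G (Metric.ball ((1:ℂ) / 2) (1 / 2)) → (∀ α ∈ Set.Ioo (0:ℝ) Real.pi, G ((Literature.Probability.LatticeModels.criticalWeight (α / 2) : ℝ) : ℂ) = ((PiH (Real.cos (α / 2) / Real.sin (α / 2)) : ℝ) : ℂ)) → deriv G ((1:ℂ) / 2) = ((c₁ : ℝ) : ℂ) := by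
  intro PiH c₁ G hG hval
  -- the critical-weight curve `c` through `1/2 = c (π/2)`, with `c′(π/2) = √3/6`
  set c : ℝ → ℂ := fun α ↦
    ((Literature.Probability.LatticeModels.criticalWeight (α / 2) : ℝ) : ℂ) with hc
  have hc_val : c (Real.pi / 2) = (1:ℂ) / 2 := by
    simp only [hc, show Real.pi / 2 / 2 = Real.pi / 4 by ring,
      Literature.Probability.LatticeModels.criticalWeight_pi_div_four]
    push_cast; ring
  have hc_der : HasDerivAt c ((Real.sqrt 3 / 6 : ℝ) : ℂ) (Real.pi / 2) :=
    hasDerivAt_criticalWeight_half.ofReal_comp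
  -- `G` is complex differentiable at the interior point `1/2` of `D`
  have hD0 : ((1:ℂ) / 2) ∈ Metric.ball ((1:ℂ) / 2) (1 / 2) :=
    Metric.mem_ball_self (by norm_num)
  have hG' : HasDerivAt G (deriv G ((1:ℂ) / 2)) (c (Real.pi / 2)) := by
    rw [hc_val]
    exact (hG.differentiableAt (Metric.isOpen_ball.mem_nhds hD0)).hasDerivAt
  have h1 : HasDerivAt (G ∘ c) (deriv G ((1:ℂ) / 2) * ((Real.sqrt 3 / 6 : ℝ) : ℂ))
      (Real.pi / 2) :=
    hG'.comp (Real.pi / 2) hc_der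
  -- the Cardy side `α ↦ Π_h (cot (α/2)) = F (λ(i cot (α/2)))` is differentiable at `π/2`
  have h2 := ((Literature.Probability.RandomPlanarGeometry.hasDerivAt_cardyFunction_lamR
    one_pos).comp_of_eq (Real.pi / 2) hasDerivAt_cot_half
      cos_div_sin_pi_div_two_half.symm).ofReal_comp
  -- and agrees with `G ∘ c` near `π/2` (on `(0, π)`, where `cot (α/2) > 0`)
  have hEq : (G ∘ c) =ᶠ[𝓝 (Real.pi / 2)] fun α ↦
      ((((fun s : ℝ ↦ Literature.Probability.RandomPlanarGeometry.cardyFunction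
          (Literature.Probability.RandomPlanarGeometry.KlebanZagier.lamR s)) ∘
        (fun α : ℝ ↦ Real.cos (α / 2) / Real.sin (α / 2))) α : ℝ) : ℂ) := by
    filter_upwards [isOpen_Ioo.mem_nhds (show Real.pi / 2 ∈ Set.Ioo (0:ℝ) Real.pi from
      ⟨by positivity, by linarith [Real.pi_pos]⟩)] with α hα
    obtain ⟨h0, hπ⟩ := hα
    have hs : 0 < Real.sin (α / 2) := Real.sin_pos_of_pos_of_lt_pi (by linarith) (by linarith)
    have hco : 0 < Real.cos (α / 2) := Real.cos_pos_of_mem_Ioo ⟨by linarith, by linarith⟩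
    have ht : 0 < Real.cos (α / 2) / Real.sin (α / 2) := div_pos hco hs
    simp only [Function.comp_apply, hc]
    rw [hval α ⟨h0, hπ⟩]
    exact congrArg Complex.ofReal (cardyPi_eq_cardyFunction_lamR ht)
  have key := h1.unique (h2.congr_of_eventuallyEq hEq)
  -- solve for `deriv G (1/2)`
  have hne : ((Real.sqrt 3 / 6 : ℝ) : ℂ) ≠ 0 := Complex.ofReal_ne_zero.2 (by positivity)
  rw [eq_div_of_mul_eq hne key, ← Complex.ofReal_div, firstJet_const_eq]

end Summit.CriticalPhenomena.CardyFormulaZ2.Theorems
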